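import Summits.AtomisticToContinuum.FouriersLaw.Theorems.BondHeatUncertaintySubdiffusiveBondHeatKernelGibbsF
import Mathlib.MeasureTheory.Integral.ExpDecay

/-!
# `PhononMeanFreePath.IncoherentBounded` — fixed-`N` decay and integrability of the equilibrium end-to-end correlations

Item `stmt-AtomisticToContinuum-11815` (support, route `PhononMeanFreePath`, sub-problem `FouriersLaw`) asks for
`sup_N |a_N| < ∞`, `a_N = N (γ²/T²) ∫_{t>0} [C_N(t) - 2 r_N(t)²] dt`, with the equilibrium two- and four-point
functions of the two END momenta of the `(N+1)`-site pinned anharmonic chain between Langevin baths at the same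
temperature `T`,
`r_N(t) = ∫ p₀ · (K_t p_N) dμ₀`, `C_N(t) = ∫ p₀² (K_t p_N²) dμ₀ - (∫ p₀² dμ₀)(∫ K_t p_N² dμ₀)`
(`μ₀ = gibbsMeasure (N+1) T`, `K_t = transitionKernel (N+1) T T t`, the CONSTRUCTED objects of
`LangevinChainGibbs` / `LangevinChainKernel`).

This file (part 1 of the fixed-`N` half of the item; part 2 is `PhononMeanFreePathIncoherentBoundedFixedN`)
derives, from the exponential ergodicity of the equilibrium chain at each `N` (Cuneo–Eckmann–Hairer–Rey-Bellet
2018, Thm 2.13 (3), in the tree as `pinnedChain_exp_convergence_gibbs`) and the kernel-level Gibbs invariance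
(`pinnedChain_integral_transitionKernel_gibbsMeasure`):

* `corr_sub_exp_decay` — for continuous `f, g` with `|f|, |g| ≤ A e^{H/(4T)}`:
  `|∫ f (K_u g) dμ_T - (∫ f dμ_T)(∫ g dμ_T)| ≤ C e^{-cu}` (`u ≥ 0`, `c > 0`); `measurable_corr` — the correlation
  `u ↦ ∫ f (K_{u⁺} g) dμ_T` is measurable (joint measurability of the constructed kernels);
* `rN_exp_decay`, `CN_exp_decay` — `|r_N(t)|, |C_N(t)| ≤ C_N e^{-c_N t}` on `t ≥ 0` (`∫ p_N dμ₀ = 0` by momentum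
  reversal, `integral_momentum_gibbsMeasure`; `∫ K_t p_N² dμ₀ = ∫ p_N² dμ₀` by invariance, `mean_act_sq_momentum`);
* `rN_sq_integrableOn`, `CN_integrableOn` — `r_N², C_N ∈ L¹(0,∞)` for EVERY `N`: the integrability clause of the
  sibling crux `CoherentDephasing` and the one inside `BoundaryKubo`'s conclusion hold outright at fixed `N`.

The constants `C_N, c_N` come from Harris' theorem and degrade with `N`; the item is exactly their `N`-uniformity
(cf. barrier file `Literature.Barriers.AtomisticToContinuum.FixedLengthNoConductivityControl`). No new definitions.
-/

noncomputable section

open MeasureTheory ProbabilityTheory Filter Topology Set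
open scoped NNReal ENNReal
open Literature.MathematicalPhysics.KineticTheory.HeatConduction
open Literature.MathematicalPhysics.KineticTheory Literature.Probability.Process OscillatorChain
open Summit.AtomisticToContinuum.FouriersLaw.Theorems.SubdiffusiveBondHeat

namespace Summit.AtomisticToContinuum.FouriersLaw.Theorems.IncoherentBounded

/-! ## 1. Equilibrium cross-correlations of the pinned chain at fixed size: decay and measurability -/

section General

variable {ω₂ lam β γ : ℝ} (hω : 0 < ω₂) (hl : 0 ≤ lam) (hβ : 0 < β) (hγ : 0 < γ) {N : ℕ} (hN : 0 < N)
  {T : ℝ} (hT : 0 < T)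
include hω hl hβ hγ hN hT

omit hβ hγ hN hT in
/-- `p_i² ≤ (2/ϑ) e^{ϑH}` for `ϑ > 0` (`p_i² ≤ 2H`, `ϑH ≤ e^{ϑH}`). [folklore] -/
theorem sq_momentum_le_exp (hβ' : 0 ≤ β) {ϑ : ℝ} (hϑ : 0 < ϑ) (z : PhaseSpace N) (i : Fin N) :
    z.2 i ^ 2 ≤ (2 / ϑ) * Real.exp (ϑ * (pinnedChain ω₂ lam β γ).hamiltonian N z) := by
  set Hz := (pinnedChain ω₂ lam β γ).hamiltonian N z
  have hH := pinnedChain_harmonic_le_hamiltonian (ω₂ := ω₂) hl hβ' γ N z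
  have h1 : 0 ≤ ∑ j, ω₂ * z.1 j ^ 2 / 2 := Finset.sum_nonneg fun j _ => by positivity
  have h2 : z.2 i ^ 2 / 2 ≤ ∑ j, z.2 j ^ 2 / 2 :=
    Finset.single_le_sum (f := fun j => z.2 j ^ 2 / 2) (fun j _ => by positivity) (Finset.mem_univ _)
  have hp : z.2 i ^ 2 ≤ 2 * Hz := by linarith
  have hexp : ϑ * Hz + 1 ≤ Real.exp (ϑ * Hz) := Real.add_one_le_exp _
  have hHle : Hz ≤ Real.exp (ϑ * Hz) / ϑ := by
    rw [le_div_iff₀ hϑ]; nlinarith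
  calc z.2 i ^ 2 ≤ 2 * Hz := hp
    _ ≤ 2 * (Real.exp (ϑ * Hz) / ϑ) := by linarith
    _ = (2 / ϑ) * Real.exp (ϑ * Hz) := by ring

omit hβ hγ hN hT in
/-- `|p_i| ≤ (1/2 + 1/ϑ) e^{ϑH}` for `ϑ > 0` (`|p| ≤ (1 + p²)/2`). [folklore] -/
theorem abs_momentum_le_exp (hβ' : 0 ≤ β) {ϑ : ℝ} (hϑ : 0 < ϑ) (z : PhaseSpace N) (i : Fin N) :
    |z.2 i| ≤ (1 / 2 + 1 / ϑ) * Real.exp (ϑ * (pinnedChain ω₂ lam β γ).hamiltonian N z) := by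
  have hsq := sq_momentum_le_exp (γ := γ) hω hl hβ' hϑ z i
  have hE1 : 1 ≤ Real.exp (ϑ * (pinnedChain ω₂ lam β γ).hamiltonian N z) :=
    Real.one_le_exp (mul_nonneg hϑ.le (pinnedChain_hamiltonian_nonneg hω.le hl hβ' γ N z))
  have hab : |z.2 i| ≤ (1 + z.2 i ^ 2) / 2 := by
    nlinarith [sq_nonneg (|z.2 i| - 1), sq_abs (z.2 i), abs_nonneg (z.2 i)]
  calc |z.2 i| ≤ (1 + z.2 i ^ 2) / 2 := hab
    _ ≤ (Real.exp (ϑ * (pinnedChain ω₂ lam β γ).hamiltonian N z) +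
          (2 / ϑ) * Real.exp (ϑ * (pinnedChain ω₂ lam β γ).hamiltonian N z)) / 2 := by
        gcongr
    _ = (1 / 2 + 1 / ϑ) * Real.exp (ϑ * (pinnedChain ω₂ lam β γ).hamiltonian N z) := by ring

/-- **Exponential decay of equilibrium cross-correlations at fixed size.** For continuous `f, g` dominated
by `A e^{H/(4T)}`, `B e^{H/(4T)}`, there are `C` and `c > 0` with
`|∫ f(z) (∫ g dK_u(z,·)) dμ_T(z) - (∫ f dμ_T)(∫ g dμ_T)| ≤ C e^{-cu}` for all `u ≥ 0`: exponential
convergence `|K_u g(z) - μ_T(g)| ≤ B C₀ e^{H(z)/(4T)} e^{-cu}` (CEHR (2.5) with the limit identified with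
the Gibbs measure) integrated against `|f| e^{H/(4T)} ≤ A e^{H/(2T)} ∈ L¹(μ_T)`.
[cite: CuneoEckmannHairerReyBellet2018, Thm 2.13 (3)] -/
theorem corr_sub_exp_decay {f g : PhaseSpace N → ℝ} (hf : Continuous f) (hg : Continuous g) {A B : ℝ}
    (hfA : ∀ y, |f y| ≤ A * Real.exp (1 / (4 * T) * (pinnedChain ω₂ lam β γ).hamiltonian N y))
    (hgB : ∀ y, |g y| ≤ B * Real.exp (1 / (4 * T) * (pinnedChain ω₂ lam β γ).hamiltonian N y)) :
    ∃ C c : ℝ, 0 < c ∧ ∀ u : ℝ≥0,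
      |(∫ z, f z * (∫ y, g y ∂((pinnedChain ω₂ lam β γ).transitionKernel N T T u z))
          ∂((pinnedChain ω₂ lam β γ).gibbsMeasure N T)) -
        (∫ z, f z ∂((pinnedChain ω₂ lam β γ).gibbsMeasure N T)) *
          (∫ z, g z ∂((pinnedChain ω₂ lam β γ).gibbsMeasure N T))| ≤ C * Real.exp (-c * u) := by
  set P := pinnedChain ω₂ lam β γ with hP
  set μ := P.gibbsMeasure N T with hμ
  haveI : IsProbabilityMeasure μ := pinnedChain_isProbabilityMeasure_gibbsMeasure hω hl hβ.le γ N hT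
  haveI : ∀ u, IsMarkovKernel (P.transitionKernel N T T u) := fun u =>
    pinnedChain_isMarkovKernel_transitionKernel hω hl hβ.le hγ.le N T T u
  set ϑ : ℝ := 1 / (4 * T) with hϑ
  have hϑ0 : 0 < ϑ := by positivity
  have hϑ1 : ϑ < 1 / T := by
    rw [hϑ, div_lt_div_iff₀ (by positivity) hT]; nlinarith
  have h2ϑ : 2 * ϑ < 1 / T := by
    rw [hϑ]; rw [show 2 * (1 / (4 * T)) = 1 / (2 * T) by field_simp; ring]
    rw [div_lt_div_iff₀ (by positivity) hT]; nlinarith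
  obtain ⟨C₀, c, hC₀, hc, hconv⟩ := pinnedChain_exp_convergence_gibbs hω hl hβ hγ hN hT hϑ0 hϑ1
  -- WLOG positive constants
  have hA0 : 0 ≤ A := by
    have := (abs_nonneg _).trans (hfA 0)
    exact nonneg_of_mul_nonneg_left this (Real.exp_pos _)
  have hB0 : 0 ≤ B := by
    have := (abs_nonneg _).trans (hgB 0)
    exact nonneg_of_mul_nonneg_left this (Real.exp_pos _)
  set B' : ℝ := B + 1 with hB'
  have hB'0 : 0 < B' := by rw [hB']; linarith
  have hgB' : ∀ y, |g y| ≤ B' * Real.exp (ϑ * P.hamiltonian N y) := fun y =>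
    (hgB y).trans (mul_le_mul_of_nonneg_right (by rw [hB']; linarith) (Real.exp_pos _).le)
  -- integrability facts
  have heϑμ : Integrable (fun y => Real.exp (ϑ * P.hamiltonian N y)) μ :=
    pinnedChain_integrable_exp_mul_hamiltonian_gibbsMeasure hω hl hβ.le γ N hT hϑ1
  have he2ϑμ : Integrable (fun y => Real.exp (2 * ϑ * P.hamiltonian N y)) μ :=
    pinnedChain_integrable_exp_mul_hamiltonian_gibbsMeasure hω hl hβ.le γ N hT h2ϑ
  have hgμ : Integrable g μ := integrable_of_abs_le_exp heϑμ hg hgB'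
  have hfμ : Integrable f μ := integrable_of_abs_le_exp heϑμ hf hfA
  -- the weight `|f| e^{ϑH} ≤ A e^{2ϑH}` is `μ`-integrable
  have hwint : Integrable (fun z => |f z| * Real.exp (ϑ * P.hamiltonian N z)) μ := by
    refine (he2ϑμ.const_mul A).mono' ((continuous_abs.comp hf).mul (Real.continuous_exp.comp
      (continuous_const.mul (pinnedChain_continuous_hamiltonian ω₂ lam β γ N)))).aestronglyMeasurable
      (Eventually.of_forall fun z => ?_)
    rw [Real.norm_eq_abs, abs_mul, abs_abs, abs_of_pos (Real.exp_pos _)]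
    calc |f z| * Real.exp (ϑ * P.hamiltonian N z) ≤ (A * Real.exp (ϑ * P.hamiltonian N z)) *
        Real.exp (ϑ * P.hamiltonian N z) := mul_le_mul_of_nonneg_right (hfA z) (Real.exp_pos _).le
      _ = A * Real.exp (2 * ϑ * P.hamiltonian N z) := by rw [mul_assoc, ← Real.exp_add]; ring_nf
  set W : ℝ := ∫ z, |f z| * Real.exp (ϑ * P.hamiltonian N z) ∂μ with hW
  set m : ℝ := ∫ z, g z ∂μ with hm
  refine ⟨B' * C₀ * W, c, hc, fun u => ?_⟩
  -- pointwise decay of `K_u g - m`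
  have hpt : ∀ z, |(∫ y, g y ∂(P.transitionKernel N T T u z)) - m| ≤
      B' * C₀ * Real.exp (ϑ * P.hamiltonian N z) * Real.exp (-c * u) := by
    intro z
    have hf' : Continuous fun y => B'⁻¹ * g y := continuous_const.mul hg
    have hfb : ∀ y, |B'⁻¹ * g y| ≤ Real.exp (ϑ * P.hamiltonian N y) := fun y => by
      rw [abs_mul, abs_of_pos (inv_pos.2 hB'0), inv_mul_le_iff₀ hB'0]
      exact hgB' y
    have h := hconv z u _ hf' hfb
    rw [integral_const_mul, integral_const_mul, ← mul_sub, abs_mul,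
      abs_of_pos (inv_pos.2 hB'0), inv_mul_le_iff₀ hB'0] at h
    calc |(∫ y, g y ∂(P.transitionKernel N T T u z)) - m|
        ≤ B' * (C₀ * Real.exp (ϑ * P.hamiltonian N z) * Real.exp (-c * u)) := h
      _ = B' * C₀ * Real.exp (ϑ * P.hamiltonian N z) * Real.exp (-c * u) := by ring
  -- `K_u g` is strongly measurable and `f · K_u g` is integrable
  set G : PhaseSpace N → ℝ := fun z => ∫ y, g y ∂(P.transitionKernel N T T u z) with hG
  have hGm : StronglyMeasurable G := hg.stronglyMeasurable.integral_kernel (κ := P.transitionKernel N T T u)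
  have hfGm : Integrable (fun z => f z * (G z - m)) μ := by
    refine (hwint.const_mul (B' * C₀ * Real.exp (-c * u))).mono'
      (hf.aestronglyMeasurable.mul (hGm.aestronglyMeasurable.sub aestronglyMeasurable_const))
      (Eventually.of_forall fun z => ?_)
    rw [Real.norm_eq_abs, abs_mul]
    calc |f z| * |G z - m| ≤ |f z| * (B' * C₀ * Real.exp (ϑ * P.hamiltonian N z) * Real.exp (-c * u)) :=
          mul_le_mul_of_nonneg_left (hpt z) (abs_nonneg _)
      _ = B' * C₀ * Real.exp (-c * u) * (|f z| * Real.exp (ϑ * P.hamiltonian N z)) := by ring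
  have hfG : Integrable (fun z => f z * G z) μ := by
    have : (fun z => f z * G z) = fun z => f z * (G z - m) + m * f z := by
      funext z; ring
    rw [this]
    exact hfGm.add (hfμ.const_mul m)
  -- `∫ f G - (∫ f) m = ∫ f (G - m)`
  have hid : (∫ z, f z * G z ∂μ) - (∫ z, f z ∂μ) * m = ∫ z, f z * (G z - m) ∂μ := by
    have : (fun z => f z * (G z - m)) = fun z => f z * G z - m * f z := by
      funext z; ring
    rw [this, integral_sub hfG (hfμ.const_mul m), integral_const_mul]
    ring
  show |(∫ z, f z * G z ∂μ) - (∫ z, f z ∂μ) * m| ≤ B' * C₀ * W * Real.exp (-c * u)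
  rw [hid]
  have hbound : ∀ z, ‖f z * (G z - m)‖ ≤
      B' * C₀ * Real.exp (-c * u) * (|f z| * Real.exp (ϑ * P.hamiltonian N z)) := fun z => by
    rw [Real.norm_eq_abs, abs_mul]
    calc |f z| * |G z - m| ≤ |f z| * (B' * C₀ * Real.exp (ϑ * P.hamiltonian N z) * Real.exp (-c * u)) :=
          mul_le_mul_of_nonneg_left (hpt z) (abs_nonneg _)
      _ = B' * C₀ * Real.exp (-c * u) * (|f z| * Real.exp (ϑ * P.hamiltonian N z)) := by ring
  have := norm_integral_le_of_norm_le (hwint.const_mul (B' * C₀ * Real.exp (-c * u))) (Eventually.of_forall hbound)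
  rw [integral_const_mul, Real.norm_eq_abs] at this
  calc _ ≤ B' * C₀ * Real.exp (-c * u) * W := this
    _ = B' * C₀ * W * Real.exp (-c * u) := by ring

omit hN in
/-- **Measurability in time of equilibrium cross-correlations**: for continuous `f, g`,
`u ↦ ∫ f(z) (∫ g dK_{u⁺}(z,·)) dμ_T(z)` is measurable (joint measurability of the constructed kernels in
`(t, z)`, `pinnedChain_measurable_transitionKernel`). [folklore] -/
theorem measurable_corr {f g : PhaseSpace N → ℝ} (hf : Continuous f) (hg : Continuous g) :
    Measurable fun u : ℝ => ∫ z, f z *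
        (∫ y, g y ∂((pinnedChain ω₂ lam β γ).transitionKernel N T T u.toNNReal z))
      ∂((pinnedChain ω₂ lam β γ).gibbsMeasure N T) := by
  set P := pinnedChain ω₂ lam β γ with hP
  set μ := P.gibbsMeasure N T with hμ
  haveI : IsProbabilityMeasure μ := pinnedChain_isProbabilityMeasure_gibbsMeasure hω hl hβ.le γ N hT
  -- the kernels as ONE kernel on `ℝ≥0 × Ω`
  let κ₂ : Kernel (ℝ≥0 × PhaseSpace N) (PhaseSpace N) :=
    { toFun := fun p => P.transitionKernel N T T p.1 p.2
      measurable' := pinnedChain_measurable_transitionKernel hω hl hβ.le hγ.le N T T }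
  have hG : StronglyMeasurable fun p : ℝ≥0 × PhaseSpace N => ∫ y, g y ∂(κ₂ p) :=
    hg.stronglyMeasurable.integral_kernel (κ := κ₂)
  have hF : StronglyMeasurable fun q : ℝ × PhaseSpace N =>
      f q.2 * ∫ y, g y ∂(P.transitionKernel N T T q.1.toNNReal q.2) := by
    have h1 : StronglyMeasurable fun q : ℝ × PhaseSpace N => f q.2 :=
      (hf.comp continuous_snd).stronglyMeasurable
    have h2 : StronglyMeasurable fun q : ℝ × PhaseSpace N => ∫ y, g y ∂(κ₂ (q.1.toNNReal, q.2)) :=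
      hG.comp_measurable ((measurable_real_toNNReal.comp measurable_fst).prodMk measurable_snd)
    exact h1.mul h2
  exact (hF.integral_prod_right' (ν := μ)).measurable

omit hN in
/-- Measurability in time of `u ↦ ∫ (∫ g dK_{u⁺}(z,·)) dμ_T(z)` for continuous `g`. [folklore] -/
theorem measurable_mean_act {g : PhaseSpace N → ℝ} (hg : Continuous g) :
    Measurable fun u : ℝ => ∫ z,
        (∫ y, g y ∂((pinnedChain ω₂ lam β γ).transitionKernel N T T u.toNNReal z))
      ∂((pinnedChain ω₂ lam β γ).gibbsMeasure N T) := by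
  have h := measurable_corr hω hl hβ hγ hT (f := fun _ => (1 : ℝ)) continuous_const hg
  simpa using h

end General


/-! ## 2. The objects of the item: `r_N`, `C_N`, the cumulant channel, `a_N` -/

section Item

variable {ω₂ lam β γ : ℝ} (hω : 0 < ω₂) (hl : 0 ≤ lam) (hβ : 0 < β) (hγ : 0 < γ) {T : ℝ} (hT : 0 < T)
include hω hl hβ hγ hT

omit hω hl hβ hγ hT in
/-- `∫ p_i dμ_T = 0`: the Gibbs density is even and `p_i` odd under momentum reversal (an identity of
junk values when `e^{-H/T}` is not integrable). [folklore] -/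
theorem integral_momentum_gibbsMeasure (ω₂ lam β γ : ℝ) (n : ℕ) (T : ℝ) (i : Fin n) :
    ∫ z, z.2 i ∂((pinnedChain ω₂ lam β γ).gibbsMeasure n T) = 0 := by
  rw [(pinnedChain ω₂ lam β γ).integral_gibbsMeasure]
  have h := integral_comp_momentumReversal n fun x =>
    x.2 i * (pinnedChain ω₂ lam β γ).gibbsDensity n T x
  simp only [OscillatorChain.gibbsDensity, OscillatorChain.hamiltonian_neg_momentum, Pi.neg_apply, neg_mul,
    integral_neg] at h
  have h0 : ∫ x, x.2 i * (pinnedChain ω₂ lam β γ).gibbsDensity n T x = 0 := by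
    simp only [OscillatorChain.gibbsDensity]
    linarith
  rw [h0, mul_zero]

/-- Invariance of the mean kinetic energy of a site along the equilibrium kernels:
`∫ (∫ p_j² dK_{t⁺}(z,·)) dμ₀(z) = ∫ p_j² dμ₀` for every real `t`. [cite: CuneoEckmannHairerReyBellet2018, §3.1] -/
theorem mean_act_sq_momentum (n : ℕ) (j : Fin (n + 1)) (t : ℝ) :
    ∫ z, (∫ y, y.2 j ^ 2 ∂((pinnedChain ω₂ lam β γ).transitionKernel (n + 1) T T t.toNNReal z))
        ∂((pinnedChain ω₂ lam β γ).gibbsMeasure (n + 1) T) =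
      ∫ z, z.2 j ^ 2 ∂((pinnedChain ω₂ lam β γ).gibbsMeasure (n + 1) T) := by
  have hϑ0 : (0 : ℝ) < 1 / (4 * T) := by positivity
  have hϑ1 : 1 / (4 * T) < 1 / T := by
    rw [div_lt_div_iff₀ (by positivity) hT]; nlinarith
  have hint : Integrable (fun z : PhaseSpace (n + 1) => z.2 j ^ 2) ((pinnedChain ω₂ lam β γ).gibbsMeasure (n + 1) T) :=
    integrable_of_abs_le_exp (pinnedChain_integrable_exp_mul_hamiltonian_gibbsMeasure hω hl hβ.le γ (n + 1) hT hϑ1)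
      (by fun_prop) (fun y => by
        rw [abs_of_nonneg (sq_nonneg _)]
        exact sq_momentum_le_exp (γ := γ) hω hl hβ.le hϑ0 y j)
  exact pinnedChain_integral_transitionKernel_gibbsMeasure hω hl hβ.le hγ.le (Nat.succ_pos n) hT _ hint

/-- **Exponential decay of the end-to-end momentum pair correlation at fixed size**:
`|r_N(t)| ≤ C_N e^{-c_N t}` for `t ≥ 0` (`c_N > 0`), `r_N(t) = ∫ p₀ (K_t p_N) dμ₀`, since `∫ p₀ dμ₀ = 0`.
[cite: CuneoEckmannHairerReyBellet2018, Thm 2.13 (3)] -/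
theorem rN_exp_decay (N : ℕ) :
    ∃ C c : ℝ, 0 < c ∧ ∀ t : ℝ, 0 ≤ t →
      |∫ z, z.2 0 * (∫ y, y.2 (Fin.last N) ∂((pinnedChain ω₂ lam β γ).transitionKernel (N + 1) T T t.toNNReal z))
        ∂((pinnedChain ω₂ lam β γ).gibbsMeasure (N + 1) T)| ≤ C * Real.exp (-c * t) := by
  have hϑ0 : (0 : ℝ) < 1 / (4 * T) := by positivity
  obtain ⟨C, c, hc, hb⟩ := corr_sub_exp_decay hω hl hβ hγ (Nat.succ_pos N) hT
    (f := fun z : PhaseSpace (N + 1) => z.2 0) (g := fun z : PhaseSpace (N + 1) => z.2 (Fin.last N))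
    (by fun_prop) (by fun_prop) (fun y => abs_momentum_le_exp hω hl hβ.le hϑ0 y 0)
    (fun y => abs_momentum_le_exp hω hl hβ.le hϑ0 y (Fin.last N))
  refine ⟨C, c, hc, fun t ht => ?_⟩
  have h := hb t.toNNReal
  rwa [integral_momentum_gibbsMeasure, zero_mul, sub_zero, Real.coe_toNNReal _ ht] at h

/-- `t ↦ r_N(t)` is measurable. [folklore] -/
theorem measurable_rN (N : ℕ) :
    Measurable fun t : ℝ => ∫ z, z.2 0 *
        (∫ y, y.2 (Fin.last N) ∂((pinnedChain ω₂ lam β γ).transitionKernel (N + 1) T T t.toNNReal z))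
      ∂((pinnedChain ω₂ lam β γ).gibbsMeasure (N + 1) T) :=
  measurable_corr hω hl hβ hγ hT (by fun_prop) (by fun_prop)

/-- **The integrability clause of `CoherentDephasing` holds at every `N`**: `t ↦ r_N(t)²` is integrable on
`(0, ∞)` (`r_N² ≤ C_N² e^{-2c_N t}`). [cite: CuneoEckmannHairerReyBellet2018, Thm 2.13 (3)] -/
theorem rN_sq_integrableOn (N : ℕ) :
    IntegrableOn (fun t : ℝ => (∫ z, z.2 0 *
        (∫ y, y.2 (Fin.last N) ∂((pinnedChain ω₂ lam β γ).transitionKernel (N + 1) T T t.toNNReal z))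
      ∂((pinnedChain ω₂ lam β γ).gibbsMeasure (N + 1) T)) ^ 2) (Set.Ioi 0) := by
  obtain ⟨C, c, hc, hb⟩ := rN_exp_decay hω hl hβ hγ hT N
  have hC0 : 0 ≤ C := by
    have h := (abs_nonneg _).trans (hb 0 le_rfl)
    simpa using h
  refine Integrable.mono' ((exp_neg_integrableOn_Ioi 0 (by positivity : 0 < 2 * c)).const_mul (C ^ 2))
    ((measurable_rN hω hl hβ hγ hT N).pow_const 2).aestronglyMeasurable ?_
  refine (ae_restrict_iff' measurableSet_Ioi).2 (Eventually.of_forall fun t ht => ?_)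
  rw [Real.norm_eq_abs, abs_pow, show C ^ 2 * Real.exp (-(2 * c) * t) = (C * Real.exp (-c * t)) ^ 2 by
    rw [mul_pow, ← Real.exp_nat_mul]; ring_nf]
  exact pow_le_pow_left₀ (abs_nonneg _) (hb t (le_of_lt ht)) 2

/-- **Exponential decay of the end-to-end power covariance at fixed size**: `|C_N(t)| ≤ C_N e^{-c_N t}` for
`t ≥ 0` (`c_N > 0`), where `C_N(t) = ∫ p₀² (K_t p_N²) dμ₀ - (∫ p₀² dμ₀)(∫ K_t p_N² dμ₀)` and the last factor
equals `∫ p_N² dμ₀` by invariance. [cite: CuneoEckmannHairerReyBellet2018, Thm 2.13 (3)] -/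
theorem CN_exp_decay (N : ℕ) :
    ∃ C c : ℝ, 0 < c ∧ ∀ t : ℝ, 0 ≤ t →
      |(∫ z, (z.2 0) ^ 2 * (∫ y, (y.2 (Fin.last N)) ^ 2 ∂((pinnedChain ω₂ lam β γ).transitionKernel (N + 1) T T t.toNNReal z)) ∂((pinnedChain ω₂ lam β γ).gibbsMeasure (N + 1) T)) - (∫ z, (z.2 0) ^ 2 ∂((pinnedChain ω₂ lam β γ).gibbsMeasure (N + 1) T)) * (∫ z, (∫ y, (y.2 (Fin.last N)) ^ 2 ∂((pinnedChain ω₂ lam β γ).transitionKernel (N + 1) T T t.toNNReal z)) ∂((pinnedChain ω₂ lam β γ).gibbsMeasure (N + 1) T))| ≤ C * Real.exp (-c * t) := by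
  have hϑ0 : (0 : ℝ) < 1 / (4 * T) := by positivity
  obtain ⟨C, c, hc, hb⟩ := corr_sub_exp_decay hω hl hβ hγ (Nat.succ_pos N) hT
    (f := fun z : PhaseSpace (N + 1) => z.2 0 ^ 2) (g := fun z : PhaseSpace (N + 1) => z.2 (Fin.last N) ^ 2)
    (by fun_prop) (by fun_prop)
    (fun y => by rw [abs_of_nonneg (sq_nonneg _)]; exact sq_momentum_le_exp (γ := γ) hω hl hβ.le hϑ0 y 0)
    (fun y => by rw [abs_of_nonneg (sq_nonneg _)]; exact sq_momentum_le_exp (γ := γ) hω hl hβ.le hϑ0 y (Fin.last N))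
  refine ⟨C, c, hc, fun t ht => ?_⟩
  have h := hb t.toNNReal
  rwa [← mean_act_sq_momentum hω hl hβ hγ hT N (Fin.last N) t, Real.coe_toNNReal _ ht] at h

/-- `t ↦ C_N(t)` is measurable. [folklore] -/
theorem measurable_CN (N : ℕ) :
    Measurable fun t : ℝ => (∫ z, (z.2 0) ^ 2 * (∫ y, (y.2 (Fin.last N)) ^ 2 ∂((pinnedChain ω₂ lam β γ).transitionKernel (N + 1) T T t.toNNReal z)) ∂((pinnedChain ω₂ lam β γ).gibbsMeasure (N + 1) T)) - (∫ z, (z.2 0) ^ 2 ∂((pinnedChain ω₂ lam β γ).gibbsMeasure (N + 1) T)) * (∫ z, (∫ y, (y.2 (Fin.last N)) ^ 2 ∂((pinnedChain ω₂ lam β γ).transitionKernel (N + 1) T T t.toNNReal z)) ∂((pinnedChain ω₂ lam β γ).gibbsMeasure (N + 1) T)) :=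
  (measurable_corr hω hl hβ hγ hT (f := fun z : PhaseSpace (N + 1) => z.2 0 ^ 2)
    (g := fun z : PhaseSpace (N + 1) => z.2 (Fin.last N) ^ 2) (by fun_prop) (by fun_prop)).sub
    ((measurable_mean_act hω hl hβ hγ hT (g := fun z : PhaseSpace (N + 1) => z.2 (Fin.last N) ^ 2)
      (by fun_prop)).const_mul _)

/-- **The integrability clause inside `BoundaryKubo`'s conclusion holds at every `N`**: `C_N ∈ L¹(0, ∞)`.
[cite: CuneoEckmannHairerReyBellet2018, Thm 2.13 (3)] -/
theorem CN_integrableOn (N : ℕ) :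
    IntegrableOn (fun t : ℝ => (∫ z, (z.2 0) ^ 2 * (∫ y, (y.2 (Fin.last N)) ^ 2 ∂((pinnedChain ω₂ lam β γ).transitionKernel (N + 1) T T t.toNNReal z)) ∂((pinnedChain ω₂ lam β γ).gibbsMeasure (N + 1) T)) - (∫ z, (z.2 0) ^ 2 ∂((pinnedChain ω₂ lam β γ).gibbsMeasure (N + 1) T)) * (∫ z, (∫ y, (y.2 (Fin.last N)) ^ 2 ∂((pinnedChain ω₂ lam β γ).transitionKernel (N + 1) T T t.toNNReal z)) ∂((pinnedChain ω₂ lam β γ).gibbsMeasure (N + 1) T))) (Set.Ioi 0) := by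
  obtain ⟨C, c, hc, hb⟩ := CN_exp_decay hω hl hβ hγ hT N
  refine Integrable.mono' ((exp_neg_integrableOn_Ioi 0 hc).const_mul C)
    (measurable_CN hω hl hβ hγ hT N).aestronglyMeasurable ?_
  refine (ae_restrict_iff' measurableSet_Ioi).2 (Eventually.of_forall fun t ht => ?_)
  rw [Real.norm_eq_abs]
  exact hb t (le_of_lt ht)

end Item

end Summit.AtomisticToContinuum.FouriersLaw.Theorems.IncoherentBounded

end
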